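import Mathlib.Analysis.Calculus.InverseFunctionTheorem.ContDiff
import Mathlib.Analysis.Calculus.MeanValue
import Mathlib.Analysis.Normed.Operator.Prod
import Mathlib.Analysis.Normed.Group.FunctionSeries
import Mathlib.Analysis.SpecificLimits.Basic
import Literature.Analysis.Complex.WeierstrassBanach
import Literature.Analysis.Complex.HolomorphicFramesOfKernels
import HarnessLib

/-!
# Poincaré–Koenigs linearisation with parameters (expanding scalar multiplier)

[cite: Koenigs1884] [cite: Milnor2006, Thm. 8.2, Rem. 8.3, Cor. 8.4] [cite: Sternberg1957, Thm. 1]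
[cite: FritzscheGrauert2002, Ch. I §7 Thm. 7.5, Thm. 7.6]

Let `P`, `W` be finite-dimensional complex normed spaces, `N ⊆ P × W` open, and `G : P × W → W` holomorphic on `N`
with `G (b, 0) = 0` and fibre derivative `∂_w G (b, 0) = c • id` along the zero section, where `1 < ‖c‖` (an
EXPANDING SCALAR multiplier; a scalar multiplier has no resonances).  KOENIGS'S THEOREM WITH PARAMETERS
(Milnor, *Dynamics in One Complex Variable*, Thm. 8.2 with Rem. 8.3 on holomorphic dependence on parameters; Koenigs
1884 in one variable; Sternberg 1957 for the local-contraction formulation) says that near `(b₀, 0)` the family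
`G (b, ·)` is holomorphically conjugate, holomorphically in `b`, to the linear map `w ↦ c • w`.

We prove this over Mathlib in the following form (all radii are radii of balls, all sets products of balls):

* §1 `exists_holomorphic_param_inverse` — the PARAMETRISED HOLOMORPHIC INVERSE FUNCTION THEOREM: a holomorphic family
  `F (b, ·)` with `F (b, 0) = 0` and `∂_w F (b, 0) = A` invertible has a jointly holomorphic family of local inverses
  `H (b, ·)`, with two-sided inverse identities and a linear bound, on a product of balls (Mathlib's `C^n` inverse
  function theorem `ContDiffAt.toOpenPartialHomeomorph` applied to `(b, w) ↦ (b, F (b, w))`, plus the tree's SCV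
  bridge ★ `analyticOnNhd_of_differentiableOn_of_finiteDimensional`).
* §2 `koenigs_limit` — KOENIGS'S LIMIT `Ψ = lim_k c^k • H (b, ·)^{∘k}` for a holomorphic family of contractions `H`
  that is `M‖v‖²`-close to `v ↦ c⁻¹ • v` with `‖c‖ θ² < 1`: uniform convergence of the telescoping series, joint
  holomorphy by the tree's ★ `WeierstrassBanach.differentiableOn_of_tendstoUniformlyOn`, `‖Ψ (b, w) − w‖ ≤ C‖w‖²`,
  `∂_w Ψ (b, 0) = id`, and the functional equation; and `exists_linearization` — the theorem itself: `Ψ` holomorphic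
  (indeed analytic) on a product of balls inside `N`, `Ψ (b, 0) = 0`, `∂_w Ψ (b, 0) = id`, and
  `Ψ (b, G (b, w)) = c • Ψ (b, w)` (apply §1 to `G` to get the contracting inverse family `H`, whose fibre derivative
  is `M‖v‖`-Lipschitz by `ContDiffAt.exists_lipschitzOnWith`, then §2 on suitably small balls).
* §3 `exists_linearization_with_inverse`, `exists_parametrization` — the inverse coordinate `Θ (b, ·) = Ψ (b, ·)⁻¹`
  (§1 applied to `Ψ`): holomorphic, `Θ (b, 0) = 0`, `∂_v Θ (b, 0) = id`, injective in `v`, and the PARAMETRISATION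
  `G (b, Θ (b, v)) = Θ (b, c • v)`; and `exists_linearizing_openPartialHomeomorph` — the same data packaged as an
  `OpenPartialHomeomorph` `𝒦 = (b, w) ↦ (b, Ψ (b, w))` of `P × W` over the first projection, analytic with analytic
  inverse, target a product of balls, conjugating `(b, w) ↦ (b, G (b, w))` to `(b, v) ↦ (b, c • v)`.

THEOREMS ONLY (no `def`, no `instance`, no notation); every statement is over Mathlib declarations; the `private`
[folklore] lemmas of §0 and §2 are calculus plumbing (fibre derivatives, mean-value bounds, `O(‖w‖²) ⇒ derivative id`).
-/

noncomputable section

namespace Literature.Analysis.Complex.KoenigsLinearization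

open Metric Set Filter
open scoped Topology

variable {P : Type*} [NormedAddCommGroup P] [NormedSpace ℂ P]
variable {W : Type*} [NormedAddCommGroup W] [NormedSpace ℂ W]

/-! ## §0 Bookkeeping: partial derivatives along the fibre factor -/

/-- [folklore] The partial derivative of a map on `P × W` along `W` is the total derivative composed with `inr`. -/
private theorem hasFDerivAt_partial {f : P × W → W} {b : P} {v : W} (hf : DifferentiableAt ℂ f (b, v)) :
    HasFDerivAt (fun v : W => f (b, v)) ((fderiv ℂ f (b, v)).comp (ContinuousLinearMap.inr ℂ P W)) v :=
  hf.hasFDerivAt.comp v (hasFDerivAt_prodMk_right b v)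

omit [NormedAddCommGroup P] [NormedSpace ℂ P] in
/-- [folklore] Mean value inequality along the fibre: a map vanishing on the zero section whose fibre derivative is
bounded by `K` on a ball satisfies `‖f (b, v)‖ ≤ K‖v‖` there. -/
private theorem norm_le_of_partial_le {f : P × W → W} {b : P} {s K : ℝ} {D : W → W →L[ℂ] W}
    (hf : ∀ v ∈ ball (0 : W) s, HasFDerivAt (fun v : W => f (b, v)) (D v) v)
    (hK : ∀ v ∈ ball (0 : W) s, ‖D v‖ ≤ K) (h0 : f (b, 0) = 0) {v : W} (hv : v ∈ ball (0 : W) s) :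
    ‖f (b, v)‖ ≤ K * ‖v‖ := by
  have hs : (0 : W) ∈ ball (0 : W) s := mem_ball_self (lt_of_le_of_lt (norm_nonneg v) (mem_ball_zero_iff.mp hv))
  have h := (convex_ball (0 : W) s).norm_image_sub_le_of_norm_hasFDerivWithin_le
    (f := fun v : W => f (b, v)) (fun x hx => (hf x hx).hasFDerivWithinAt) hK hs hv
  simpa [h0] using h

omit [NormedAddCommGroup P] [NormedSpace ℂ P] in
/-- [folklore] Second-order mean value inequality along the fibre: if the fibre derivative is `M‖v‖`-close to a fixed
`φ` on the ball, and `f (b, 0) = 0`, then `‖f (b, v) - φ v‖ ≤ M‖v‖²`. -/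
private theorem norm_sub_le_sq_of_partial {f : P × W → W} {b : P} {s M : ℝ} {D : W → W →L[ℂ] W} {φ : W →L[ℂ] W}
    (hf : ∀ v ∈ ball (0 : W) s, HasFDerivAt (fun v : W => f (b, v)) (D v) v)
    (hM : ∀ v ∈ ball (0 : W) s, ‖D v - φ‖ ≤ M * ‖v‖) (hMnn : 0 ≤ M) (h0 : f (b, 0) = 0) {v : W}
    (hv : v ∈ ball (0 : W) s) : ‖f (b, v) - φ v‖ ≤ M * ‖v‖ ^ 2 := by
  -- work on the convex set `ball 0 s ∩ closedBall 0 ‖v‖`, where the derivative is `M‖v‖`-close to `φ`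
  set T : Set W := ball (0 : W) s ∩ closedBall (0 : W) ‖v‖ with hT
  have hTc : Convex ℝ T := (convex_ball _ _).inter (convex_closedBall _ _)
  have hs : 0 < s := lt_of_le_of_lt (norm_nonneg v) (mem_ball_zero_iff.mp hv)
  have h0T : (0 : W) ∈ T := ⟨mem_ball_self hs, by simp⟩
  have hvT : v ∈ T := ⟨hv, by simp⟩
  have h := hTc.norm_image_sub_le_of_norm_hasFDerivWithin_le' (f := fun v : W => f (b, v)) (φ := φ)
    (C := M * ‖v‖) (fun x hx => ((hf x hx.1).hasFDerivWithinAt)) (fun x hx => ?_) h0T hvT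
  · have : ‖f (b, v) - φ v‖ ≤ M * ‖v‖ * ‖v‖ := by simpa [h0] using h
    simpa [pow_two, mul_assoc] using this
  · have hx' : ‖x‖ ≤ ‖v‖ := by simpa using hx.2
    exact (hM x hx.1).trans (mul_le_mul_of_nonneg_left hx' hMnn)

omit [NormedSpace ℂ P] [NormedSpace ℂ W] in
/-- [folklore] Membership in a ball of the product (sup metric) from memberships in the factors. -/
private theorem mem_ball_prod_of {b b₀ : P} {v : W} {ρ r s : ℝ} (hb : b ∈ ball b₀ ρ) (hv : v ∈ ball (0 : W) r)
    (hρ : ρ ≤ s) (hr : r ≤ s) : (b, v) ∈ ball ((b₀, (0 : W)) : P × W) s := by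
  rw [mem_ball, Prod.dist_eq]
  exact max_lt (lt_of_lt_of_le (mem_ball.mp hb) hρ) (lt_of_lt_of_le (mem_ball.mp hv) hr)

omit [NormedSpace ℂ P] [NormedSpace ℂ W] in
/-- [folklore] The fibre component of a point of `P × W` close to `(b₀, 0)` is small. -/
private theorem norm_snd_lt_of_mem_ball {q : P × W} {b₀ : P} {s : ℝ} (hq : q ∈ ball ((b₀, (0 : W)) : P × W) s) :
    ‖q.2‖ < s := by
  have h : dist q (b₀, (0 : W)) < s := mem_ball.mp hq
  rw [Prod.dist_eq] at h
  have h2 := lt_of_le_of_lt (le_max_right _ _) h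
  simpa [dist_zero_right] using h2

/-! ## §1 Parametrised holomorphic inverse function theorem -/

variable [FiniteDimensional ℂ P] [FiniteDimensional ℂ W]

/-- **PARAMETRISED HOLOMORPHIC INVERSE FUNCTION THEOREM** [cite: FritzscheGrauert2002, Ch. I §7 Thm. 7.5, Thm. 7.6]
(the inverse mapping ∕ implicit function theorems; here Mathlib's `ContDiffAt.toOpenPartialHomeomorph` applied to
`(b, w) ↦ (b, F (b, w))`): if `F : P × W → W` is holomorphic on an open `N ∋ (b₀, 0)`, `F (b, 0) = 0` and
`∂_w F (b, 0) = A` (a fixed invertible `A`) whenever `(b, 0) ∈ N`, then on a product of balls there is a jointly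
holomorphic `H` with `H (b, 0) = 0`, `∂_v H (b, 0) = A⁻¹`, `‖H (b, v)‖ ≤ K‖v‖`, `(b, H (b, v)) ∈ N`,
`F (b, H (b, v)) = v`, and `H (b, F (b, w)) = w` for `w` small. -/
theorem exists_holomorphic_param_inverse {F : P × W → W} {N : Set (P × W)} {b₀ : P} (hN : IsOpen N)
    (hb₀ : (b₀, (0 : W)) ∈ N) (hF : DifferentiableOn ℂ F N) (hF0 : ∀ b : P, (b, (0 : W)) ∈ N → F (b, 0) = 0)
    (A : W ≃L[ℂ] W) (hA : ∀ b : P, (b, (0 : W)) ∈ N → fderiv ℂ (fun w : W => F (b, w)) 0 = (A : W →L[ℂ] W)) :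
    ∃ ρ > (0 : ℝ), ∃ r > (0 : ℝ), ∃ r₁ > (0 : ℝ), ∃ K : ℝ, ∃ H : P × W → W,
      ball b₀ ρ ×ˢ ball (0 : W) r₁ ⊆ N ∧
      DifferentiableOn ℂ H (ball b₀ ρ ×ˢ ball (0 : W) r) ∧
      (∀ b ∈ ball b₀ ρ, H (b, 0) = 0) ∧
      (∀ b ∈ ball b₀ ρ, HasFDerivAt (fun v : W => H (b, v)) (A.symm : W →L[ℂ] W) 0) ∧
      (∀ b ∈ ball b₀ ρ, ∀ v ∈ ball (0 : W) r, ‖H (b, v)‖ ≤ K * ‖v‖) ∧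
      (∀ b ∈ ball b₀ ρ, ∀ v ∈ ball (0 : W) r, H (b, v) ∈ ball (0 : W) r₁ ∧ F (b, H (b, v)) = v) ∧
      (∀ b ∈ ball b₀ ρ, ∀ w ∈ ball (0 : W) r₁, H (b, F (b, w)) = w) := by
  -- (A) analyticity and the derivative of `𝒢 (b, w) = (b, F (b, w))` at `(b₀, 0)`
  have hFan : AnalyticOnNhd ℂ F N :=
    analyticOnNhd_of_differentiableOn_of_finiteDimensional hN hF
  set 𝒢 : P × W → P × W := fun q => (q.1, F q) with h𝒢def
  have hNn : N ∈ 𝓝 (b₀, (0 : W)) := hN.mem_nhds hb₀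
  set L : P × W →L[ℂ] W := fderiv ℂ F (b₀, 0) with hLdef
  have hFL : HasFDerivAt F L (b₀, 0) := (hF.differentiableAt hNn).hasFDerivAt
  -- `L ∘ inl = 0` because `b ↦ F (b, 0)` vanishes near `b₀`
  have hLinl : L.comp (ContinuousLinearMap.inl ℂ P W) = 0 := by
    have h1 : HasFDerivAt (fun b : P => F (b, 0)) (L.comp (ContinuousLinearMap.inl ℂ P W)) b₀ :=
      hFL.comp b₀ (hasFDerivAt_prodMk_left b₀ (0 : W))
    have hnear : ∀ᶠ b in 𝓝 b₀, (b, (0 : W)) ∈ N :=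
      (Continuous.prodMk_left (0 : W)).continuousAt.preimage_mem_nhds (by simpa using hNn)
    have h2 : HasFDerivAt (fun b : P => F (b, 0)) (0 : P →L[ℂ] W) b₀ := by
      refine (hasFDerivAt_const (0 : W) b₀).congr_of_eventuallyEq ?_
      filter_upwards [hnear] with b hb using hF0 b hb
    exact h1.unique h2
  -- `L ∘ inr = A`
  have hLinr : L.comp (ContinuousLinearMap.inr ℂ P W) = (A : W →L[ℂ] W) := by
    have h1 : HasFDerivAt (fun w : W => F (b₀, w)) (L.comp (ContinuousLinearMap.inr ℂ P W)) 0 :=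
      hasFDerivAt_partial (hF.differentiableAt hNn)
    exact h1.fderiv.symm.trans (hA b₀ hb₀)
  have hLeq : L = (A : W →L[ℂ] W).comp (ContinuousLinearMap.snd ℂ P W) := by
    refine ContinuousLinearMap.ext fun q => ?_
    obtain ⟨p, w⟩ := q
    have e1 : L (p, 0) = 0 := by simpa using DFunLike.congr_fun hLinl p
    have e2 : L (0, w) = A w := by simpa using DFunLike.congr_fun hLinr w
    calc L (p, w) = L ((p, 0) + (0, w)) := by simp
      _ = L (p, 0) + L (0, w) := map_add L _ _
      _ = ((A : W →L[ℂ] W).comp (ContinuousLinearMap.snd ℂ P W)) (p, w) := by simp [e1, e2]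
  -- the derivative of `𝒢` as a continuous linear equivalence
  set D₁ : P × W →L[ℂ] P × W :=
    (ContinuousLinearMap.fst ℂ P W).prod ((A : W →L[ℂ] W).comp (ContinuousLinearMap.snd ℂ P W)) with hD₁
  set D₂ : P × W →L[ℂ] P × W :=
    (ContinuousLinearMap.fst ℂ P W).prod ((A.symm : W →L[ℂ] W).comp (ContinuousLinearMap.snd ℂ P W)) with hD₂
  have hD12 : Function.LeftInverse D₂ D₁ := fun q => by simp [hD₁, hD₂]
  have hD21 : Function.RightInverse D₂ D₁ := fun q => by simp [hD₁, hD₂]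
  set 𝒟 : (P × W) ≃L[ℂ] (P × W) := ContinuousLinearEquiv.equivOfInverse D₁ D₂ hD12 hD21 with h𝒟
  have h𝒢d : HasFDerivAt 𝒢 (𝒟 : P × W →L[ℂ] P × W) (b₀, 0) := by
    have : HasFDerivAt 𝒢 D₁ (b₀, 0) := by
      have hF' : HasFDerivAt F ((A : W →L[ℂ] W).comp (ContinuousLinearMap.snd ℂ P W)) (b₀, 0) := hLeq ▸ hFL
      exact hasFDerivAt_fst.prodMk hF'
    exact this
  have h𝒢c : ContDiffAt ℂ 2 𝒢 (b₀, 0) := contDiffAt_fst.prodMk (hFan _ hb₀).contDiffAt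
  have hn : (2 : WithTop ℕ∞) ≠ 0 := by norm_num
  -- (B) the local inverse
  set e := h𝒢c.toOpenPartialHomeomorph 𝒢 h𝒢d hn with hedef
  have he : (e : P × W → P × W) = 𝒢 := rfl
  have h𝒢b₀ : 𝒢 (b₀, 0) = (b₀, 0) := by simp [h𝒢def, hF0 b₀ hb₀]
  have hsrc : (b₀, (0 : W)) ∈ e.source := h𝒢c.mem_toOpenPartialHomeomorph_source h𝒢d hn
  have htgt : (b₀, (0 : W)) ∈ e.target := by
    have := h𝒢c.image_mem_toOpenPartialHomeomorph_target h𝒢d hn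
    rwa [h𝒢b₀] at this
  set E := (e.symm : P × W → P × W) with hEdef
  have hEcd : ContDiffAt ℂ 2 E (b₀, 0) := by
    have := h𝒢c.to_localInverse h𝒢d hn
    rwa [h𝒢b₀] at this
  -- identities
  have right_id : ∀ y ∈ e.target, (E y).1 = y.1 ∧ F ((E y).1, (E y).2) = y.2 := by
    intro y hy
    have h := e.right_inv hy
    rw [he] at h
    have h' : ((E y).1, F (E y)) = y := h
    have h1 := congrArg Prod.fst h'
    have h2 := congrArg Prod.snd h'
    simp only at h1 h2
    exact ⟨h1, by simpa using h2⟩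
  have left_id : ∀ x ∈ e.source, E (x.1, F x) = x := by
    intro x hx
    have h := e.left_inv hx
    rw [he] at h
    exact h
  have hE0 : E (b₀, 0) = (b₀, 0) := by
    have := left_id (b₀, 0) hsrc
    simpa [hF0 b₀ hb₀] using this
  -- (C) radii.  Source side: `ball (b₀,0) r₁ ⊆ e.source ∩ N`.
  obtain ⟨r₁, hr₁, hr₁sub⟩ : ∃ r₁ > (0 : ℝ), ball ((b₀, (0 : W)) : P × W) r₁ ⊆ e.source ∩ N :=
    Metric.mem_nhds_iff.mp (Filter.inter_mem (e.open_source.mem_nhds hsrc) hNn)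
  -- target side: `E` is `C²` (hence differentiable) on an open `t ∋ (b₀, 0)`
  obtain ⟨t₁, ht₁, ht₁sub⟩ : ∃ t₁ > (0 : ℝ), ∀ y ∈ ball ((b₀, (0 : W)) : P × W) t₁, ContDiffAt ℂ 2 E y :=
    Metric.eventually_nhds_iff_ball.mp (hEcd.eventually (by simp))
  obtain ⟨t₂, ht₂, ht₂sub⟩ : ∃ t₂ > (0 : ℝ), ball ((b₀, (0 : W)) : P × W) t₂ ⊆ e.target :=
    Metric.mem_nhds_iff.mp (e.open_target.mem_nhds htgt)
  -- bound `K` on `fderiv E` near `(b₀, 0)`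
  obtain ⟨δ, hδ, hδsub⟩ : ∃ δ > (0 : ℝ), ∀ y ∈ ball ((b₀, (0 : W)) : P × W) δ,
      dist (fderiv ℂ E y) (fderiv ℂ E (b₀, 0)) < 1 := by
    have hc : ContinuousAt (fderiv ℂ E) (b₀, 0) := hEcd.continuousAt_fderiv hn
    exact Metric.eventually_nhds_iff_ball.mp (Metric.tendsto_nhds.mp hc 1 one_pos)
  set K : ℝ := ‖fderiv ℂ E (b₀, 0)‖ + 1 with hKdef
  have hKbd : ∀ y ∈ ball ((b₀, (0 : W)) : P × W) δ, ‖fderiv ℂ E y‖ ≤ K := by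
    intro y hy
    have h := hδsub y hy
    rw [dist_eq_norm] at h
    calc ‖fderiv ℂ E y‖ = ‖fderiv ℂ E (b₀, 0) + (fderiv ℂ E y - fderiv ℂ E (b₀, 0))‖ := by rw [add_sub_cancel]
      _ ≤ ‖fderiv ℂ E (b₀, 0)‖ + ‖fderiv ℂ E y - fderiv ℂ E (b₀, 0)‖ := norm_add_le _ _
      _ ≤ K := by rw [hKdef]; exact add_le_add le_rfl h.le
  -- `E` maps a small ball into `ball (b₀,0) r₁`
  obtain ⟨r₂, hr₂, hr₂sub⟩ : ∃ r₂ > (0 : ℝ), ∀ y ∈ ball ((b₀, (0 : W)) : P × W) r₂,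
      E y ∈ ball ((b₀, (0 : W)) : P × W) r₁ := by
    have hc : ContinuousAt E (b₀, 0) := hEcd.continuousAt
    have h := Metric.tendsto_nhds.mp hc r₁ hr₁
    rw [hE0] at h
    exact Metric.eventually_nhds_iff_ball.mp h
  -- the radii
  set r : ℝ := min (min t₁ t₂) (min δ r₂) with hrdef
  have hr : 0 < r := lt_min (lt_min ht₁ ht₂) (lt_min hδ hr₂)
  have hrt₁ : r ≤ t₁ := (min_le_left _ _).trans (min_le_left _ _)
  have hrt₂ : r ≤ t₂ := (min_le_left _ _).trans (min_le_right _ _)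
  have hrδ : r ≤ δ := (min_le_right _ _).trans (min_le_left _ _)
  have hrr₂ : r ≤ r₂ := (min_le_right _ _).trans (min_le_right _ _)
  set ρ : ℝ := min r r₁ with hρdef
  have hρ : 0 < ρ := lt_min hr hr₁
  have hρr : ρ ≤ r := min_le_left _ _
  have hρr₁ : ρ ≤ r₁ := min_le_right _ _
  -- the inverse family
  set H : P × W → W := fun y => (E y).2 with hHdef
  -- memberships
  have memT : ∀ b ∈ ball b₀ ρ, ∀ v ∈ ball (0 : W) r, (b, v) ∈ ball ((b₀, (0 : W)) : P × W) r :=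
    fun b hb v hv => mem_ball_prod_of hb hv hρr le_rfl
  have memS : ∀ b ∈ ball b₀ ρ, ∀ w ∈ ball (0 : W) r₁, (b, w) ∈ e.source ∧ (b, w) ∈ N :=
    fun b hb w hw => hr₁sub (mem_ball_prod_of hb hw hρr₁ le_rfl)
  have memS0 : ∀ b ∈ ball b₀ ρ, (b, (0 : W)) ∈ e.source ∧ (b, (0 : W)) ∈ N :=
    fun b hb => memS b hb 0 (mem_ball_self hr₁)
  have hEdiff : ∀ b ∈ ball b₀ ρ, ∀ v ∈ ball (0 : W) r, DifferentiableAt ℂ E (b, v) :=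
    fun b hb v hv => (ht₁sub _ (ball_subset_ball hrt₁ (memT b hb v hv))).differentiableAt hn
  have hEtgt : ∀ b ∈ ball b₀ ρ, ∀ v ∈ ball (0 : W) r, (b, v) ∈ e.target :=
    fun b hb v hv => ht₂sub (ball_subset_ball hrt₂ (memT b hb v hv))
  -- fibre derivative of `H`
  set Dv : P × W → W →L[ℂ] W := fun y =>
    (ContinuousLinearMap.snd ℂ P W).comp ((fderiv ℂ E y).comp (ContinuousLinearMap.inr ℂ P W)) with hDvdef
  have hHd : ∀ b ∈ ball b₀ ρ, ∀ v ∈ ball (0 : W) r, HasFDerivAt (fun v : W => H (b, v)) (Dv (b, v)) v := by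
    intro b hb v hv
    have h1 : HasFDerivAt (fun v : W => E (b, v)) ((fderiv ℂ E (b, v)).comp (ContinuousLinearMap.inr ℂ P W)) v :=
      (hEdiff b hb v hv).hasFDerivAt.comp v (hasFDerivAt_prodMk_right b v)
    exact hasFDerivAt_snd.comp v h1
  have hH0 : ∀ b ∈ ball b₀ ρ, H (b, 0) = 0 := by
    intro b hb
    have h := left_id (b, 0) (memS0 b hb).1
    have h' : E (b, 0) = (b, 0) := by simpa [hF0 b (memS0 b hb).2] using h
    simp [hHdef, h']
  have hFH : ∀ b ∈ ball b₀ ρ, ∀ v ∈ ball (0 : W) r, F (b, H (b, v)) = v := by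
    intro b hb v hv
    obtain ⟨h1, h2⟩ := right_id (b, v) (hEtgt b hb v hv)
    simp only at h1 h2
    simpa [hHdef, h1] using h2
  refine ⟨ρ, hρ, r, hr, r₁, hr₁, K, H, ?_, ?_, hH0, ?_, ?_, ?_, ?_⟩
  · -- `ball b₀ ρ ×ˢ ball 0 r₁ ⊆ N`
    rintro ⟨b, w⟩ ⟨hb, hw⟩
    exact (memS b hb w hw).2
  · -- holomorphy of `H`
    rintro ⟨b, v⟩ ⟨hb, hv⟩
    exact ((hEdiff b hb v hv).snd).differentiableWithinAt
  · -- `∂_v H (b, 0) = A⁻¹`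
    intro b hb
    have h0r : (0 : W) ∈ ball (0 : W) r := mem_ball_self hr
    have hHd0 : HasFDerivAt (fun v : W => H (b, v)) (Dv (b, 0)) 0 := hHd b hb 0 h0r
    -- `F (b, ·)` has derivative `A` at `H (b, 0) = 0`
    have hFb : HasFDerivAt (fun w : W => F (b, w)) (A : W →L[ℂ] W) (H (b, 0)) := by
      rw [hH0 b hb, ← hA b (memS0 b hb).2]
      exact (hasFDerivAt_partial (hF.differentiableAt (hN.mem_nhds (memS0 b hb).2))).differentiableAt.hasFDerivAt
    have hcomp : HasFDerivAt (fun v : W => F (b, H (b, v))) ((A : W →L[ℂ] W).comp (Dv (b, 0))) 0 := by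
      have := hFb.comp 0 hHd0
      simpa [Function.comp_def] using this
    have hid : HasFDerivAt (fun v : W => F (b, H (b, v))) (ContinuousLinearMap.id ℂ W) 0 := by
      refine (hasFDerivAt_id (0 : W)).congr_of_eventuallyEq ?_
      filter_upwards [isOpen_ball.mem_nhds h0r] with v hv using hFH b hb v hv
    have heq : (A : W →L[ℂ] W).comp (Dv (b, 0)) = ContinuousLinearMap.id ℂ W := hcomp.unique hid
    have : Dv (b, 0) = (A.symm : W →L[ℂ] W) := by
      have h2 : (A.symm : W →L[ℂ] W).comp ((A : W →L[ℂ] W).comp (Dv (b, 0))) = Dv (b, 0) := by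
        ext u; simp
      rw [← h2, heq]; ext u; simp
    rw [← this]; exact hHd0
  · -- `‖H (b, v)‖ ≤ K‖v‖`
    intro b hb v hv
    refine norm_le_of_partial_le (fun x hx => hHd b hb x hx) (fun x hx => ?_) (hH0 b hb) hv
    have hK1 := hKbd (b, x) (ball_subset_ball hrδ (memT b hb x hx))
    have hK0 : 0 ≤ K := (norm_nonneg _).trans hK1
    have a1 : ‖(fderiv ℂ E (b, x)).comp (ContinuousLinearMap.inr ℂ P W)‖ ≤ K :=
      calc ‖(fderiv ℂ E (b, x)).comp (ContinuousLinearMap.inr ℂ P W)‖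
            ≤ ‖fderiv ℂ E (b, x)‖ * ‖ContinuousLinearMap.inr ℂ P W‖ := ContinuousLinearMap.opNorm_comp_le _ _
        _ ≤ K * 1 := mul_le_mul hK1 (ContinuousLinearMap.norm_inr_le_one ℂ P W) (norm_nonneg _) hK0
        _ = K := mul_one K
    calc ‖Dv (b, x)‖ ≤ ‖ContinuousLinearMap.snd ℂ P W‖ * ‖(fderiv ℂ E (b, x)).comp (ContinuousLinearMap.inr ℂ P W)‖ :=
          ContinuousLinearMap.opNorm_comp_le _ _
      _ ≤ 1 * K := mul_le_mul (ContinuousLinearMap.norm_snd_le ℂ P W) a1 (norm_nonneg _) zero_le_one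
      _ = K := one_mul K
  · -- `H (b, v) ∈ ball 0 r₁` and `F (b, H (b, v)) = v`
    intro b hb v hv
    refine ⟨?_, hFH b hb v hv⟩
    have hEy := hr₂sub (b, v) (ball_subset_ball hrr₂ (memT b hb v hv))
    have h1 : ‖(E (b, v) - (b₀, 0)).2‖ < r₁ := by
      have := norm_snd_lt_of_mem_ball (b₀ := b₀) (s := r₁) (q := E (b, v) - (b₀, 0) + (b₀, 0)) (by simpa using hEy)
      simpa using this
    simpa [hHdef, mem_ball_zero_iff] using h1
  · -- `H (b, F (b, w)) = w`
    intro b hb w hw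
    have h := left_id (b, w) (memS b hb w hw).1
    simp only at h
    simp [hHdef, h]

/-! ## §2 Koenigs linearisation with parameters -/

/-- [folklore] For `1 < κ` there is `θ₀` with `κ⁻¹ < θ₀` such that every `0 ≤ θ < θ₀` has `κ θ² < 1` (namely
`θ₀ = √κ⁻¹`): room for a contraction constant slightly worse than `κ⁻¹` whose square still beats `κ`. -/
private theorem exists_contraction_room {κ : ℝ} (hκ : 1 < κ) :
    ∃ θ₀ : ℝ, κ⁻¹ < θ₀ ∧ ∀ θ : ℝ, 0 ≤ θ → θ < θ₀ → κ * θ ^ 2 < 1 := by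
  have hκ0 : 0 < κ := zero_lt_one.trans hκ
  have hs0 : 0 < κ⁻¹ := inv_pos.mpr hκ0
  have hs1 : κ⁻¹ < 1 := inv_lt_one_of_one_lt₀ hκ
  refine ⟨Real.sqrt κ⁻¹, ?_, fun θ hθ hθlt => ?_⟩
  · rw [Real.lt_sqrt hs0.le]; nlinarith
  · have h1 : θ ^ 2 < κ⁻¹ := (Real.lt_sqrt hθ).mp hθlt
    calc κ * θ ^ 2 < κ * κ⁻¹ := by gcongr
      _ = 1 := mul_inv_cancel₀ hκ0.ne'

omit [FiniteDimensional ℂ P] [FiniteDimensional ℂ W] in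
/-- [folklore] A map `O(‖w‖²)`-close to the identity near `0` has derivative `id` at `0`. -/
private theorem hasFDerivAt_id_of_norm_sub_le_sq {f : W → W} {s C : ℝ} (hs : 0 < s) (hC : 0 ≤ C) (hf0 : f 0 = 0)
    (h : ∀ w ∈ ball (0 : W) s, ‖f w - w‖ ≤ C * ‖w‖ ^ 2) : HasFDerivAt f (ContinuousLinearMap.id ℂ W) 0 := by
  have hf : HasFDerivAt (fun w : W => f w - w) (0 : W →L[ℂ] W) 0 := by
    rw [hasFDerivAt_iff_isLittleO_nhds_zero]
    refine Asymptotics.isLittleO_iff.mpr fun e he => ?_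
    have hC1 : 0 < C + 1 := by linarith
    have hrad : 0 < min s (e / (C + 1)) := lt_min hs (div_pos he hC1)
    filter_upwards [ball_mem_nhds (0 : W) hrad] with w hw
    have hw1 : w ∈ ball (0 : W) s := ball_subset_ball (min_le_left _ _) hw
    have hw2 : ‖w‖ ≤ e / (C + 1) := (mem_ball_zero_iff.mp (ball_subset_ball (min_le_right _ _) hw)).le
    have key : C * (e / (C + 1)) ≤ e := by
      rw [mul_div_assoc', div_le_iff₀ hC1]; nlinarith
    simp [hf0]
    calc ‖f w - w‖ ≤ C * ‖w‖ ^ 2 := h w hw1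
      _ = (C * ‖w‖) * ‖w‖ := by ring
      _ ≤ (C * (e / (C + 1))) * ‖w‖ := by gcongr
      _ ≤ e * ‖w‖ := by gcongr
  have h2 := hf.add (hasFDerivAt_id (0 : W))
  simp only [zero_add] at h2
  exact h2.congr_of_eventuallyEq (Eventually.of_forall fun w => by simp)

omit [FiniteDimensional ℂ P] in
set_option maxHeartbeats 800000 in
/-- **KOENIGS'S LIMIT** [cite: Milnor2006, Thm. 8.2 (proof), Rem. 8.3] [cite: Koenigs1884], with
parameters: if `H (b, ·)` is a holomorphic family of `θ`-contractions of `ball 0 r` fixing `0`, `M‖v‖²`-close to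
`v ↦ c⁻¹ • v`, with `‖c‖ θ² < 1`, then `Ψ := lim_k c^k • H (b, ·)^{∘k}` exists uniformly, is jointly holomorphic,
`C‖w‖²`-close to the identity, and turns `H (b, ·)` into division by `c`: `Ψ (b, w') = c • Ψ (b, w)` when `H (b, w') = w`. -/
theorem koenigs_limit {H : P × W → W} {b₀ : P} {ρ r θ M : ℝ} {c : ℂ} (hr : 0 < r) (hc : 1 < ‖c‖)
    (hHd : DifferentiableOn ℂ H (ball b₀ ρ ×ˢ ball (0 : W) r)) (hH0 : ∀ b ∈ ball b₀ ρ, H (b, 0) = 0)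
    (hθ0 : 0 ≤ θ) (hθ1 : θ ≤ 1) (hM : 0 ≤ M) (hq : ‖c‖ * θ ^ 2 < 1)
    (hHθ : ∀ b ∈ ball b₀ ρ, ∀ v ∈ ball (0 : W) r, ‖H (b, v)‖ ≤ θ * ‖v‖)
    (hHsq : ∀ b ∈ ball b₀ ρ, ∀ v ∈ ball (0 : W) r, ‖H (b, v) - c⁻¹ • v‖ ≤ M * ‖v‖ ^ 2) :
    ∃ C : ℝ, ∃ Ψ : P × W → W,
      DifferentiableOn ℂ Ψ (ball b₀ ρ ×ˢ ball (0 : W) r) ∧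
      (∀ b ∈ ball b₀ ρ, Ψ (b, 0) = 0) ∧
      (∀ b ∈ ball b₀ ρ, HasFDerivAt (fun w : W => Ψ (b, w)) (ContinuousLinearMap.id ℂ W) 0) ∧
      (∀ b ∈ ball b₀ ρ, ∀ w ∈ ball (0 : W) r, ‖Ψ (b, w) - w‖ ≤ C * ‖w‖ ^ 2) ∧
      (∀ b ∈ ball b₀ ρ, ∀ w ∈ ball (0 : W) r, ∀ w' ∈ ball (0 : W) r, H (b, w') = w → Ψ (b, w') = c • Ψ (b, w)) := by
  set κ : ℝ := ‖c‖ with hκdef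
  have hκ0 : 0 < κ := zero_lt_one.trans hc
  have hc0 : c ≠ 0 := by
    rintro rfl
    norm_num [hκdef] at hc
  have hq0 : 0 ≤ κ * θ ^ 2 := by positivity
  set U : Set (P × W) := ball b₀ ρ ×ˢ ball (0 : W) r with hUdef
  have hUo : IsOpen U := isOpen_ball.prod isOpen_ball
  -- (1) the iterates `it k (b, w) = H (b, ·)^[k] w`
  set it : ℕ → P × W → W := fun k q => (fun w : W => H (q.1, w))^[k] q.2 with hitdef
  have it_zero : ∀ q, it 0 q = q.2 := fun q => rfl
  have it_succ : ∀ k q, it (k + 1) q = H (q.1, it k q) := fun k q => Function.iterate_succ_apply' _ k q.2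
  have it_bd : ∀ k, ∀ b ∈ ball b₀ ρ, ∀ w ∈ ball (0 : W) r,
      ‖it k (b, w)‖ ≤ θ ^ k * ‖w‖ ∧ it k (b, w) ∈ ball (0 : W) r := by
    intro k b hb w hw
    induction k with
    | zero => exact ⟨by simp [it_zero], by simpa [it_zero] using hw⟩
    | succ k ih =>
      obtain ⟨ih1, ih2⟩ := ih
      have h1 : ‖it (k + 1) (b, w)‖ ≤ θ ^ (k + 1) * ‖w‖ := by
        rw [it_succ]
        calc ‖H (b, it k (b, w))‖ ≤ θ * ‖it k (b, w)‖ := hHθ b hb _ ih2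
          _ ≤ θ * (θ ^ k * ‖w‖) := by gcongr
          _ = θ ^ (k + 1) * ‖w‖ := by ring
      refine ⟨h1, mem_ball_zero_iff.mpr (lt_of_le_of_lt h1 ?_)⟩
      calc θ ^ (k + 1) * ‖w‖ ≤ 1 * ‖w‖ := by gcongr; exact pow_le_one₀ hθ0 hθ1
        _ < r := by rw [one_mul]; exact mem_ball_zero_iff.mp hw
  have it_diff : ∀ k, DifferentiableOn ℂ (it k) U := by
    intro k
    induction k with
    | zero => exact differentiableOn_snd.congr fun q _ => it_zero q
    | succ k ih =>
      have hmaps : MapsTo (fun q : P × W => (q.1, it k q)) U U := by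
        rintro ⟨b, w⟩ ⟨hb, hw⟩
        exact ⟨hb, (it_bd k b hb w hw).2⟩
      exact (hHd.comp (differentiableOn_fst.prodMk ih) hmaps).congr fun q _ => it_succ k q
  -- (2) the telescoping differences `d k = c^(k+1) • it (k+1) - c^k • it k` and their geometric majorant
  set T : ℕ → P × W → W := fun k q => c ^ k • it k q with hTdef
  set d : ℕ → P × W → W := fun k q => T (k + 1) q - T k q with hddef
  have d_eq : ∀ k q, d k q = c ^ (k + 1) • (H (q.1, it k q) - c⁻¹ • it k q) := by
    intro k q
    have h1 : c ^ (k + 1) • (c⁻¹ • it k q) = c ^ k • it k q := by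
      rw [smul_smul, pow_succ, mul_assoc, mul_inv_cancel₀ hc0, mul_one]
    simp only [hddef, hTdef]
    rw [it_succ, smul_sub, h1]
  have d_bd : ∀ k, ∀ b ∈ ball b₀ ρ, ∀ w ∈ ball (0 : W) r,
      ‖d k (b, w)‖ ≤ M * κ * ‖w‖ ^ 2 * (κ * θ ^ 2) ^ k := by
    intro k b hb w hw
    obtain ⟨h1, h2⟩ := it_bd k b hb w hw
    have h3 : ‖H (b, it k (b, w)) - c⁻¹ • it k (b, w)‖ ≤ M * (θ ^ k * ‖w‖) ^ 2 :=
      (hHsq b hb _ h2).trans (by gcongr)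
    rw [d_eq, norm_smul, norm_pow]
    calc ‖c‖ ^ (k + 1) * ‖H (b, it k (b, w)) - c⁻¹ • it k (b, w)‖
          ≤ κ ^ (k + 1) * (M * (θ ^ k * ‖w‖) ^ 2) := by rw [← hκdef]; gcongr
      _ = M * κ * ‖w‖ ^ 2 * (κ * θ ^ 2) ^ k := by ring
  have d_bd' : ∀ k, ∀ q ∈ U, ‖d k q‖ ≤ M * κ * r ^ 2 * (κ * θ ^ 2) ^ k := by
    rintro k ⟨b, w⟩ ⟨hb, hw⟩
    have hw' : ‖w‖ ≤ r := (mem_ball_zero_iff.mp hw).le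
    calc ‖d k (b, w)‖ ≤ M * κ * ‖w‖ ^ 2 * (κ * θ ^ 2) ^ k := d_bd k b hb w hw
      _ ≤ M * κ * r ^ 2 * (κ * θ ^ 2) ^ k := by gcongr
  have hsumm : Summable fun k : ℕ => M * κ * r ^ 2 * (κ * θ ^ 2) ^ k :=
    (summable_geometric_of_lt_one hq0 hq).mul_left _
  -- (3) the limit `Ψ`
  set Ψ : P × W → W := fun q => q.2 + ∑' k, d k q with hΨdef
  have T_eq : ∀ n q, T n q = q.2 + ∑ k ∈ Finset.range n, d k q := by
    intro n q
    have h := Finset.sum_range_sub (fun k => T k q) n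
    simp only [hddef]
    rw [h]
    simp [hTdef, it_zero]
  have hlim : TendstoUniformlyOn T Ψ atTop U := by
    have hS := tendstoUniformlyOn_tsum_nat hsumm d_bd'
    rw [Metric.tendstoUniformlyOn_iff] at hS ⊢
    intro e he
    filter_upwards [hS e he] with n hn q hq
    have h1 := hn q hq
    rw [T_eq, hΨdef, dist_eq_norm] at *
    simpa using h1
  have hΨd : DifferentiableOn ℂ Ψ U :=
    WeierstrassBanach.differentiableOn_of_tendstoUniformlyOn hUo hlim
      (Eventually.of_forall fun n => (it_diff n).const_smul (c ^ n))
  have hΨpt : ∀ q ∈ U, Tendsto (fun n => T n q) atTop (𝓝 (Ψ q)) := fun q hq => hlim.tendsto_at hq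
  -- (4) properties of `Ψ`
  have hΨ0 : ∀ b ∈ ball b₀ ρ, Ψ (b, 0) = 0 := by
    intro b hb
    have hq' : ((b, (0 : W)) : P × W) ∈ U := ⟨hb, mem_ball_self hr⟩
    have hT0 : ∀ n, T n (b, 0) = 0 := by
      intro n
      have : it n (b, 0) = 0 := Function.iterate_fixed (hH0 b hb) n
      simp [hTdef, this]
    have h1 : Tendsto (fun n => T n (b, 0)) atTop (𝓝 0) := by
      simp only [hT0]; exact tendsto_const_nhds
    exact tendsto_nhds_unique (hΨpt _ hq') h1
  set C : ℝ := M * κ / (1 - κ * θ ^ 2) with hCdef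
  have hC0 : 0 ≤ C := div_nonneg (by positivity) (by linarith)
  have hΨsq : ∀ b ∈ ball b₀ ρ, ∀ w ∈ ball (0 : W) r, ‖Ψ (b, w) - w‖ ≤ C * ‖w‖ ^ 2 := by
    intro b hb w hw
    have h1 : Ψ (b, w) - w = ∑' k, d k (b, w) := by simp [hΨdef]
    rw [h1]
    have hgeo : HasSum (fun k : ℕ => M * κ * ‖w‖ ^ 2 * (κ * θ ^ 2) ^ k)
        (M * κ * ‖w‖ ^ 2 * (1 - κ * θ ^ 2)⁻¹) :=
      (hasSum_geometric_of_lt_one hq0 hq).mul_left _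
    calc ‖∑' k, d k (b, w)‖ ≤ M * κ * ‖w‖ ^ 2 * (1 - κ * θ ^ 2)⁻¹ :=
          tsum_of_norm_bounded hgeo (fun k => d_bd k b hb w hw)
      _ = C * ‖w‖ ^ 2 := by rw [hCdef]; ring
  have hΨder : ∀ b ∈ ball b₀ ρ, HasFDerivAt (fun w : W => Ψ (b, w)) (ContinuousLinearMap.id ℂ W) 0 :=
    fun b hb => hasFDerivAt_id_of_norm_sub_le_sq hr hC0 (hΨ0 b hb) (fun w hw => hΨsq b hb w hw)
  have hΨconj : ∀ b ∈ ball b₀ ρ, ∀ w ∈ ball (0 : W) r, ∀ w' ∈ ball (0 : W) r, H (b, w') = w →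
      Ψ (b, w') = c • Ψ (b, w) := by
    intro b hb w hw w' hw' hHw
    have hshift : ∀ k, T (k + 1) (b, w') = c • T k (b, w) := by
      intro k
      have : it (k + 1) (b, w') = it k (b, w) := by
        simp only [hitdef]
        rw [Function.iterate_succ_apply]
        simp only [hHw]
      simp only [hTdef, this, pow_succ, mul_smul]
      rw [smul_comm]
    have h1 : Tendsto (fun k => T (k + 1) (b, w')) atTop (𝓝 (Ψ (b, w'))) :=
      (hΨpt _ ⟨hb, hw'⟩).comp (tendsto_add_atTop_nat 1)
    have h2 : Tendsto (fun k => c • T k (b, w)) atTop (𝓝 (c • Ψ (b, w))) :=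
      (hΨpt _ ⟨hb, hw⟩).const_smul c
    simp only [hshift] at h1
    exact tendsto_nhds_unique h1 h2
  exact ⟨C, Ψ, hΨd, hΨ0, hΨder, hΨsq, hΨconj⟩

set_option maxHeartbeats 800000 in
/-- **POINCARÉ–KOENIGS LINEARISATION WITH PARAMETERS, EXPANDING SCALAR MULTIPLIER** [cite: Koenigs1884]
[cite: Milnor2006, Thm. 8.2, Rem. 8.3, Cor. 8.4] [cite: Sternberg1957, Thm. 1]: `G (b, ·)` fixes `0` with
derivative `c • id`, `1 < ‖c‖`, holomorphically in `(b, w)`; then a holomorphic (indeed analytic) `Ψ`, tangent to the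
identity in `w` along `w = 0` (indeed `‖Ψ (b, w) − w‖ ≤ C‖w‖²`), conjugates `G (b, ·)` to `w ↦ c • w` on a product of
balls. -/
theorem exists_linearization {G : P × W → W} {N : Set (P × W)} {b₀ : P} {c : ℂ} (hN : IsOpen N)
    (hb₀ : (b₀, (0 : W)) ∈ N) (hG : DifferentiableOn ℂ G N) (hG0 : ∀ b : P, (b, (0 : W)) ∈ N → G (b, 0) = 0)
    (hGd : ∀ b : P, (b, (0 : W)) ∈ N → fderiv ℂ (fun w : W => G (b, w)) 0 = c • ContinuousLinearMap.id ℂ W)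
    (hc : 1 < ‖c‖) :
    ∃ ρ > (0 : ℝ), ∃ r > (0 : ℝ), ∃ C : ℝ, ∃ Ψ : P × W → W,
      ball b₀ ρ ×ˢ ball (0 : W) r ⊆ N ∧
      DifferentiableOn ℂ Ψ (ball b₀ ρ ×ˢ ball (0 : W) r) ∧
      AnalyticOnNhd ℂ Ψ (ball b₀ ρ ×ˢ ball (0 : W) r) ∧
      (∀ b ∈ ball b₀ ρ, Ψ (b, 0) = 0) ∧
      (∀ b ∈ ball b₀ ρ, HasFDerivAt (fun w : W => Ψ (b, w)) (ContinuousLinearMap.id ℂ W) 0) ∧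
      (∀ b ∈ ball b₀ ρ, ∀ w ∈ ball (0 : W) r, ‖Ψ (b, w) - w‖ ≤ C * ‖w‖ ^ 2) ∧
      (∀ b ∈ ball b₀ ρ, ∀ w ∈ ball (0 : W) r, G (b, w) ∈ ball (0 : W) r → Ψ (b, G (b, w)) = c • Ψ (b, w)) := by
  -- (0) the multiplier
  set κ : ℝ := ‖c‖ with hκdef
  have hκ0 : 0 < κ := zero_lt_one.trans hc
  have hc0 : c ≠ 0 := by
    rintro rfl
    norm_num [hκdef] at hc
  have hκinv : ‖c⁻¹‖ = κ⁻¹ := by rw [norm_inv]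
  set A : W ≃L[ℂ] W := ContinuousLinearEquiv.equivOfInverse (c • ContinuousLinearMap.id ℂ W)
    (c⁻¹ • ContinuousLinearMap.id ℂ W) (fun w => by simp [hc0]) (fun w => by simp [hc0]) with hAdef
  have hAcoe : (A : W →L[ℂ] W) = c • ContinuousLinearMap.id ℂ W := rfl
  have hAsymm : (A.symm : W →L[ℂ] W) = c⁻¹ • ContinuousLinearMap.id ℂ W := rfl
  -- (1) the contracting inverse family `H`
  obtain ⟨ρ, hρ, r, hr, r₁, hr₁, K, H, hsubN, hHd, hH0, hHder, -, hHinv, hHleft⟩ :=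
    exists_holomorphic_param_inverse hN hb₀ hG hG0 A (fun b hb => by rw [hGd b hb, hAcoe])
  set U : Set (P × W) := ball b₀ ρ ×ˢ ball (0 : W) r with hUdef
  have hUo : IsOpen U := isOpen_ball.prod isOpen_ball
  have hU0 : ((b₀, (0 : W)) : P × W) ∈ U := ⟨mem_ball_self hρ, mem_ball_self hr⟩
  have hHan : AnalyticOnNhd ℂ H U := analyticOnNhd_of_differentiableOn_of_finiteDimensional hUo hHd
  have hH2 : ContDiffOn ℂ 2 H U := hHan.contDiffOn_of_completeSpace
  have hD1 : ContDiffOn ℂ 1 (fderiv ℂ H) U := hH2.fderiv_of_isOpen hUo (by norm_num)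
  -- (2) `fderiv ℂ H` is Lipschitz near `(b₀, 0)` (it is `C¹`)
  obtain ⟨Kl, t, ht, hLip⟩ := ((hD1 _ hU0).contDiffAt (hUo.mem_nhds hU0)).exists_lipschitzOnWith
  obtain ⟨δ, hδ, hδt⟩ := Metric.mem_nhds_iff.mp ht
  set M : ℝ := (Kl : ℝ) + 1 with hMdef
  have hM0 : 0 < M := by positivity
  have hKM : (Kl : ℝ) ≤ M := by rw [hMdef]; linarith
  -- (3) the radii: `θ = κ⁻¹ + M r'` must satisfy `κ θ² < 1`
  obtain ⟨θ₀, hθ₀, hroom⟩ := exists_contraction_room hc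
  set ε : ℝ := (θ₀ - κ⁻¹) / 2 with hεdef
  have hε : 0 < ε := by rw [hεdef]; linarith
  set r' : ℝ := min (min r r₁) (min δ (ε / M)) with hr'def
  have hr' : 0 < r' := lt_min (lt_min hr hr₁) (lt_min hδ (div_pos hε hM0))
  have hr'r : r' ≤ r := (min_le_left _ _).trans (min_le_left _ _)
  have hr'r₁ : r' ≤ r₁ := (min_le_left _ _).trans (min_le_right _ _)
  have hr'δ : r' ≤ δ := (min_le_right _ _).trans (min_le_left _ _)
  have hr'ε : M * r' ≤ ε := by
    have : r' ≤ ε / M := (min_le_right _ _).trans (min_le_right _ _)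
    calc M * r' ≤ M * (ε / M) := by gcongr
      _ = ε := mul_div_cancel₀ ε hM0.ne'
  set ρ' : ℝ := min ρ r' with hρ'def
  have hρ' : 0 < ρ' := lt_min hρ hr'
  have hρ'ρ : ρ' ≤ ρ := min_le_left _ _
  have hρ'r' : ρ' ≤ r' := min_le_right _ _
  set θ : ℝ := κ⁻¹ + M * r' with hθdef
  have hθ0 : 0 ≤ θ := by positivity
  have hθlt : θ < θ₀ := by rw [hθdef]; linarith
  have hq1 : κ * θ ^ 2 < 1 := hroom θ hθ0 hθlt
  have hθ1 : θ ≤ 1 := by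
    by_contra hcon
    push Not at hcon
    have h1 : 1 < θ ^ 2 := by nlinarith
    have h2 : 1 < κ * θ ^ 2 := by nlinarith
    linarith
  -- memberships
  have bρ : ∀ b ∈ ball b₀ ρ', b ∈ ball b₀ ρ := fun b hb => ball_subset_ball hρ'ρ hb
  have memU : ∀ b ∈ ball b₀ ρ', ∀ v ∈ ball (0 : W) r', (b, v) ∈ U :=
    fun b hb v hv => ⟨bρ b hb, ball_subset_ball hr'r hv⟩
  have memt : ∀ b ∈ ball b₀ ρ', ∀ v ∈ ball (0 : W) r', ((b, v) : P × W) ∈ t :=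
    fun b hb v hv => hδt (mem_ball_prod_of hb hv (hρ'r'.trans hr'δ) hr'δ)
  -- (4) the fibre derivative of `H` and its Lipschitz bound
  set Dv : P × W → W →L[ℂ] W := fun y => (fderiv ℂ H y).comp (ContinuousLinearMap.inr ℂ P W) with hDvdef
  have hHD : ∀ y ∈ U, HasFDerivAt (fun v : W => H (y.1, v)) (Dv y) y.2 := fun y hy =>
    hasFDerivAt_partial ((hHd _ hy).differentiableAt (hUo.mem_nhds hy))
  have hDv0 : ∀ b ∈ ball b₀ ρ, Dv (b, 0) = c⁻¹ • ContinuousLinearMap.id ℂ W := by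
    intro b hb
    have h1 := hHD (b, 0) ⟨hb, mem_ball_self hr⟩
    rw [← hAsymm]
    exact h1.unique (hHder b hb)
  have hDvLip : ∀ b ∈ ball b₀ ρ', ∀ v ∈ ball (0 : W) r', ‖Dv (b, v) - Dv (b, 0)‖ ≤ M * ‖v‖ := by
    intro b hb v hv
    have h1 := hLip.norm_sub_le (memt b hb v hv) (memt b hb 0 (mem_ball_self hr'))
    have h2 : ‖((b, v) : P × W) - (b, 0)‖ = ‖v‖ := by simp [Prod.norm_def]
    rw [h2] at h1
    have hsub : Dv (b, v) - Dv (b, 0) =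
        (fderiv ℂ H (b, v) - fderiv ℂ H (b, 0)).comp (ContinuousLinearMap.inr ℂ P W) := by
      simp only [hDvdef, ContinuousLinearMap.sub_comp]
    rw [hsub]
    calc ‖(fderiv ℂ H (b, v) - fderiv ℂ H (b, 0)).comp (ContinuousLinearMap.inr ℂ P W)‖
          ≤ ‖fderiv ℂ H (b, v) - fderiv ℂ H (b, 0)‖ * ‖ContinuousLinearMap.inr ℂ P W‖ :=
            ContinuousLinearMap.opNorm_comp_le _ _
      _ ≤ ((Kl : ℝ) * ‖v‖) * 1 :=
            mul_le_mul h1 (ContinuousLinearMap.norm_inr_le_one ℂ P W) (norm_nonneg _) (by positivity)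
      _ ≤ M * ‖v‖ := by rw [mul_one]; gcongr
  -- (5) contraction and second-order estimate for `H (b, ·)` on `ball 0 r'`
  have hDvθ : ∀ b ∈ ball b₀ ρ', ∀ v ∈ ball (0 : W) r', ‖Dv (b, v)‖ ≤ θ := by
    intro b hb v hv
    have h1 := hDvLip b hb v hv
    have h2 : ‖Dv (b, 0)‖ ≤ κ⁻¹ := by
      rw [hDv0 b (bρ b hb), norm_smul, hκinv]
      calc κ⁻¹ * ‖ContinuousLinearMap.id ℂ W‖ ≤ κ⁻¹ * 1 := by
            gcongr; exact ContinuousLinearMap.norm_id_le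
        _ = κ⁻¹ := mul_one _
    have h3 : ‖v‖ ≤ r' := (mem_ball_zero_iff.mp hv).le
    calc ‖Dv (b, v)‖ = ‖Dv (b, 0) + (Dv (b, v) - Dv (b, 0))‖ := by rw [add_sub_cancel]
      _ ≤ ‖Dv (b, 0)‖ + ‖Dv (b, v) - Dv (b, 0)‖ := norm_add_le _ _
      _ ≤ κ⁻¹ + M * ‖v‖ := add_le_add h2 h1
      _ ≤ κ⁻¹ + M * r' := by gcongr
  have hHθ : ∀ b ∈ ball b₀ ρ', ∀ v ∈ ball (0 : W) r', ‖H (b, v)‖ ≤ θ * ‖v‖ := fun b hb v hv =>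
    norm_le_of_partial_le (fun x hx => hHD (b, x) (memU b hb x hx)) (fun x hx => hDvθ b hb x hx)
      (hH0 b (bρ b hb)) hv
  have hHsq : ∀ b ∈ ball b₀ ρ', ∀ v ∈ ball (0 : W) r', ‖H (b, v) - c⁻¹ • v‖ ≤ M * ‖v‖ ^ 2 := by
    intro b hb v hv
    have h := norm_sub_le_sq_of_partial (φ := c⁻¹ • ContinuousLinearMap.id ℂ W)
      (fun x hx => hHD (b, x) (memU b hb x hx)) (fun x hx => ?_) hM0.le (hH0 b (bρ b hb)) hv
    · simpa using h
    · rw [← hDv0 b (bρ b hb)]; exact hDvLip b hb x hx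
  -- (6) Koenigs's limit on the product `ball b₀ ρ' ×ˢ ball 0 r'`
  have hHd' : DifferentiableOn ℂ H (ball b₀ ρ' ×ˢ ball (0 : W) r') :=
    hHd.mono (Set.prod_mono (ball_subset_ball hρ'ρ) (ball_subset_ball hr'r))
  obtain ⟨C, Ψ, hΨd, hΨ0, hΨder, hΨsq, hΨconj⟩ :=
    koenigs_limit hr' hc hHd' (fun b hb => hH0 b (bρ b hb)) hθ0 hθ1 hM0.le hq1 hHθ hHsq
  have hU'o : IsOpen (ball b₀ ρ' ×ˢ ball (0 : W) r') := isOpen_ball.prod isOpen_ball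
  refine ⟨ρ', hρ', r', hr', C, Ψ, ?_, hΨd, analyticOnNhd_of_differentiableOn_of_finiteDimensional hU'o hΨd,
    hΨ0, hΨder, hΨsq, fun b hb w hw hGw => ?_⟩
  · rintro ⟨b, w⟩ ⟨hb, hw⟩
    exact hsubN ⟨bρ b hb, ball_subset_ball hr'r₁ hw⟩
  · exact hΨconj b hb w hw (G (b, w)) hGw (hHleft b (bρ b hb) w (ball_subset_ball hr'r₁ hw))

/-! ## §3 The linearising parametrisation `Θ = Ψ⁻¹` and the linearising chart -/

/-- **KOENIGS'S COORDINATE WITH ITS INVERSE** [cite: Milnor2006, Thm. 8.2, Rem. 8.3, Cor. 8.4] [cite: Sternberg1957, Thm. 1]: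
the common construction behind `exists_parametrization` and `exists_linearizing_openPartialHomeomorph` — Koenigs's
`Ψ` of `exists_linearization` together with its parametrised local inverse `Θ` (§1 applied to `Ψ`), on products of
balls with a common base radius: `Ψ ∘ Θ = id` on `ball 0 s`, `Θ ∘ Ψ = id` on `ball 0 r₁ ⊆ ball 0 r`, fibrewise. -/
theorem exists_linearization_with_inverse {G : P × W → W} {N : Set (P × W)} {b₀ : P} {c : ℂ} (hN : IsOpen N)
    (hb₀ : (b₀, (0 : W)) ∈ N) (hG : DifferentiableOn ℂ G N) (hG0 : ∀ b : P, (b, (0 : W)) ∈ N → G (b, 0) = 0)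
    (hGd : ∀ b : P, (b, (0 : W)) ∈ N → fderiv ℂ (fun w : W => G (b, w)) 0 = c • ContinuousLinearMap.id ℂ W)
    (hc : 1 < ‖c‖) :
    ∃ ρ > (0 : ℝ), ∃ r > (0 : ℝ), ∃ s > (0 : ℝ), ∃ r₁ > (0 : ℝ), ∃ K : ℝ, ∃ Ψ Θ : P × W → W,
      ball b₀ ρ ×ˢ ball (0 : W) r ⊆ N ∧
      DifferentiableOn ℂ Ψ (ball b₀ ρ ×ˢ ball (0 : W) r) ∧
      (∀ b ∈ ball b₀ ρ, Ψ (b, 0) = 0) ∧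
      (∀ b ∈ ball b₀ ρ, HasFDerivAt (fun w : W => Ψ (b, w)) (ContinuousLinearMap.id ℂ W) 0) ∧
      (∀ b ∈ ball b₀ ρ, ∀ w ∈ ball (0 : W) r, G (b, w) ∈ ball (0 : W) r → Ψ (b, G (b, w)) = c • Ψ (b, w)) ∧
      ball (0 : W) r₁ ⊆ ball (0 : W) r ∧
      DifferentiableOn ℂ Θ (ball b₀ ρ ×ˢ ball (0 : W) s) ∧
      (∀ b ∈ ball b₀ ρ, Θ (b, 0) = 0) ∧
      (∀ b ∈ ball b₀ ρ, HasFDerivAt (fun v : W => Θ (b, v)) (ContinuousLinearMap.id ℂ W) 0) ∧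
      (∀ b ∈ ball b₀ ρ, ∀ v ∈ ball (0 : W) s, ‖Θ (b, v)‖ ≤ K * ‖v‖) ∧
      (∀ b ∈ ball b₀ ρ, ∀ v ∈ ball (0 : W) s, Θ (b, v) ∈ ball (0 : W) r₁ ∧ Ψ (b, Θ (b, v)) = v) ∧
      (∀ b ∈ ball b₀ ρ, ∀ w ∈ ball (0 : W) r₁, Θ (b, Ψ (b, w)) = w) := by
  obtain ⟨ρ₁, hρ₁, r, hr, -, Ψ, hsubN, hΨd, -, hΨ0, hΨder, -, hΨconj⟩ :=
    exists_linearization hN hb₀ hG hG0 hGd hc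
  have hNΨo : IsOpen (ball b₀ ρ₁ ×ˢ ball (0 : W) r) := isOpen_ball.prod isOpen_ball
  have hmem : ((b₀, (0 : W)) : P × W) ∈ ball b₀ ρ₁ ×ˢ ball (0 : W) r := ⟨mem_ball_self hρ₁, mem_ball_self hr⟩
  obtain ⟨ρ₂, hρ₂, s, hs, r₁, hr₁, K, Θ, hsubΨ, hΘd, hΘ0, hΘder, hΘK, hΘinv, hΘleft⟩ :=
    exists_holomorphic_param_inverse (F := Ψ) hNΨo hmem hΨd (fun b hb => hΨ0 b hb.1)
      (ContinuousLinearEquiv.refl ℂ W)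
      (fun b hb => by rw [(hΨder b hb.1).fderiv, ContinuousLinearEquiv.coe_refl])
  have hid : ((ContinuousLinearEquiv.refl ℂ W).symm : W →L[ℂ] W) = ContinuousLinearMap.id ℂ W := by
    rw [ContinuousLinearEquiv.refl_symm, ContinuousLinearEquiv.coe_refl]
  set ρ : ℝ := min ρ₁ ρ₂ with hρdef
  have hρ : 0 < ρ := lt_min hρ₁ hρ₂
  have b₁ : ∀ b ∈ ball b₀ ρ, b ∈ ball b₀ ρ₁ := fun b hb => ball_subset_ball (min_le_left _ _) hb
  have b₂ : ∀ b ∈ ball b₀ ρ, b ∈ ball b₀ ρ₂ := fun b hb => ball_subset_ball (min_le_right _ _) hb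
  refine ⟨ρ, hρ, r, hr, s, hs, r₁, hr₁, K, Ψ, Θ, ?_, ?_, fun b hb => hΨ0 b (b₁ b hb),
    fun b hb => hΨder b (b₁ b hb), fun b hb => hΨconj b (b₁ b hb), ?_, ?_, fun b hb => hΘ0 b (b₂ b hb),
    fun b hb => hid ▸ hΘder b (b₂ b hb), fun b hb => hΘK b (b₂ b hb), fun b hb => hΘinv b (b₂ b hb),
    fun b hb => hΘleft b (b₂ b hb)⟩
  · exact (Set.prod_mono (ball_subset_ball (min_le_left _ _)) le_rfl).trans hsubN
  · exact hΨd.mono (Set.prod_mono (ball_subset_ball (min_le_left _ _)) le_rfl)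
  · intro w hw
    have h := hsubΨ (show ((b₀, w) : P × W) ∈ ball b₀ ρ₂ ×ˢ ball (0 : W) r₁ from ⟨mem_ball_self hρ₂, hw⟩)
    exact h.2
  · exact hΘd.mono (Set.prod_mono (ball_subset_ball (min_le_right _ _)) le_rfl)

set_option maxHeartbeats 800000 in
/-- **THE LINEARISING PARAMETRISATION** [cite: Milnor2006, Cor. 8.4] [cite: Sternberg1957, Thm. 1]: under the
hypotheses of `exists_linearization`, the fibrewise inverse `Θ (b, ·) := Ψ (b, ·)⁻¹` of Koenigs's coordinate is
holomorphic (indeed analytic) in `(b, v)` on a product of balls, fixes `0` with `∂_v Θ (b, 0) = id`, is injective in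
`v`, takes values in `N`, and PARAMETRISES the dynamics: `G (b, Θ (b, v)) = Θ (b, c • v)` whenever `‖c • v‖ < r`. -/
theorem exists_parametrization {G : P × W → W} {N : Set (P × W)} {b₀ : P} {c : ℂ} (hN : IsOpen N)
    (hb₀ : (b₀, (0 : W)) ∈ N) (hG : DifferentiableOn ℂ G N) (hG0 : ∀ b : P, (b, (0 : W)) ∈ N → G (b, 0) = 0)
    (hGd : ∀ b : P, (b, (0 : W)) ∈ N → fderiv ℂ (fun w : W => G (b, w)) 0 = c • ContinuousLinearMap.id ℂ W)
    (hc : 1 < ‖c‖) :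
    ∃ ρ > (0 : ℝ), ∃ r > (0 : ℝ), ∃ Θ : P × W → W,
      DifferentiableOn ℂ Θ (ball b₀ ρ ×ˢ ball (0 : W) r) ∧
      AnalyticOnNhd ℂ Θ (ball b₀ ρ ×ˢ ball (0 : W) r) ∧
      (∀ b ∈ ball b₀ ρ, Θ (b, 0) = 0) ∧
      (∀ b ∈ ball b₀ ρ, HasFDerivAt (fun v : W => Θ (b, v)) (ContinuousLinearMap.id ℂ W) 0) ∧
      (∀ b ∈ ball b₀ ρ, InjOn (fun v : W => Θ (b, v)) (ball (0 : W) r)) ∧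
      (∀ b ∈ ball b₀ ρ, ∀ v : W, c • v ∈ ball (0 : W) r → (b, Θ (b, v)) ∈ N ∧ G (b, Θ (b, v)) = Θ (b, c • v)) := by
  obtain ⟨ρ, hρ, r, hr, s, hs, r₁, hr₁, K, Ψ, Θ, hsubN, -, -, -, hΨconj, hr₁r, hΘd, hΘ0, hΘder, hΘK, hΘinv,
    hΘleft⟩ := exists_linearization_with_inverse hN hb₀ hG hG0 hGd hc
  have hκ1 : 1 ≤ ‖c‖ := hc.le
  -- `G` is Lipschitz near `(b₀, 0)` (it is analytic, hence `C¹`)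
  have hGan : AnalyticOnNhd ℂ G N := analyticOnNhd_of_differentiableOn_of_finiteDimensional hN hG
  obtain ⟨KG, t, ht, hGLip⟩ := ((hGan _ hb₀).contDiffAt (n := 1)).exists_lipschitzOnWith
  obtain ⟨δ, hδ, hδt⟩ := Metric.mem_nhds_iff.mp ht
  -- constants and radii
  set K₁ : ℝ := |K| + 1 with hK₁def
  have hK₁ : 0 < K₁ := by positivity
  have hKK₁ : K ≤ K₁ := by rw [hK₁def]; linarith [le_abs_self K]
  set L : ℝ := (KG : ℝ) + 1 with hLdef
  have hL : 0 < L := by positivity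
  set r' : ℝ := min (min s δ) (min (δ / K₁) (r₁ / (L * K₁))) with hr'def
  have hr' : 0 < r' := lt_min (lt_min hs hδ) (lt_min (div_pos hδ hK₁) (div_pos hr₁ (mul_pos hL hK₁)))
  have hr's : r' ≤ s := (min_le_left _ _).trans (min_le_left _ _)
  have hr'δ : r' ≤ δ := (min_le_left _ _).trans (min_le_right _ _)
  have hr'K : K₁ * r' ≤ δ := by
    have h : r' ≤ δ / K₁ := (min_le_right _ _).trans (min_le_left _ _)
    calc K₁ * r' ≤ K₁ * (δ / K₁) := by gcongr
      _ = δ := mul_div_cancel₀ δ hK₁.ne'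
  have hr'LK : L * K₁ * r' ≤ r₁ := by
    have h : r' ≤ r₁ / (L * K₁) := (min_le_right _ _).trans (min_le_right _ _)
    calc L * K₁ * r' ≤ L * K₁ * (r₁ / (L * K₁)) := by gcongr
      _ = r₁ := mul_div_cancel₀ r₁ (mul_pos hL hK₁).ne'
  set ρ' : ℝ := min ρ δ with hρ'def
  have hρ' : 0 < ρ' := lt_min hρ hδ
  have hρ'ρ : ρ' ≤ ρ := min_le_left _ _
  have hρ'δ : ρ' ≤ δ := min_le_right _ _
  have bρ : ∀ b ∈ ball b₀ ρ', b ∈ ball b₀ ρ := fun b hb => ball_subset_ball hρ'ρ hb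
  -- the bound `‖G (b, w)‖ ≤ KG ‖w‖` near `(b₀, 0)`
  have hGbd : ∀ b ∈ ball b₀ ρ', ∀ w ∈ ball (0 : W) δ, ‖G (b, w)‖ ≤ KG * ‖w‖ := by
    intro b hb w hw
    have h0 : G (b, 0) = 0 := hG0 b (hsubN ⟨bρ b hb, mem_ball_self hr⟩)
    have h1 := hGLip.norm_sub_le (hδt (mem_ball_prod_of hb hw hρ'δ le_rfl))
      (hδt (mem_ball_prod_of hb (mem_ball_self hδ) hρ'δ le_rfl))
    have h2 : ‖((b, w) : P × W) - (b, 0)‖ = ‖w‖ := by simp [Prod.norm_def]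
    rwa [h0, sub_zero, h2] at h1
  -- smallness of `v` from smallness of `c • v`
  have hvr : ∀ v : W, c • v ∈ ball (0 : W) r' → v ∈ ball (0 : W) r' := by
    intro v hv
    rw [mem_ball_zero_iff] at hv ⊢
    rw [norm_smul] at hv
    calc ‖v‖ = 1 * ‖v‖ := (one_mul _).symm
      _ ≤ ‖c‖ * ‖v‖ := by gcongr
      _ < r' := hv
  have hU'o : IsOpen (ball b₀ ρ' ×ˢ ball (0 : W) r') := isOpen_ball.prod isOpen_ball
  have hΘd' : DifferentiableOn ℂ Θ (ball b₀ ρ' ×ˢ ball (0 : W) r') :=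
    hΘd.mono (Set.prod_mono (ball_subset_ball hρ'ρ) (ball_subset_ball hr's))
  refine ⟨ρ', hρ', r', hr', Θ, hΘd', analyticOnNhd_of_differentiableOn_of_finiteDimensional hU'o hΘd',
    fun b hb => hΘ0 b (bρ b hb), fun b hb => hΘder b (bρ b hb), fun b hb => ?_, fun b hb v hcv => ?_⟩
  · -- injectivity from the left inverse `Ψ (b, ·)`
    intro v₁ hv₁ v₂ hv₂ heq
    have h1 := (hΘinv b (bρ b hb) v₁ (ball_subset_ball hr's hv₁)).2
    have h2 := (hΘinv b (bρ b hb) v₂ (ball_subset_ball hr's hv₂)).2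
    simp only at heq
    rw [← h1, ← h2, heq]
  · -- the conjugacy, transported through `Θ = Ψ⁻¹`
    have hv : v ∈ ball (0 : W) r' := hvr v hcv
    obtain ⟨hw₁, hΨΘ⟩ := hΘinv b (bρ b hb) v (ball_subset_ball hr's hv)
    have hwr : Θ (b, v) ∈ ball (0 : W) r := hr₁r hw₁
    have hwN : ((b, Θ (b, v)) : P × W) ∈ N := hsubN ⟨bρ b hb, hwr⟩
    -- `G (b, Θ (b, v))` is small
    have hΘv : ‖Θ (b, v)‖ ≤ K₁ * ‖v‖ :=
      (hΘK b (bρ b hb) v (ball_subset_ball hr's hv)).trans (by gcongr)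
    have hvn : ‖v‖ < r' := mem_ball_zero_iff.mp hv
    have hwδ : Θ (b, v) ∈ ball (0 : W) δ := by
      rw [mem_ball_zero_iff]
      calc ‖Θ (b, v)‖ ≤ K₁ * ‖v‖ := hΘv
        _ < K₁ * r' := by gcongr
        _ ≤ δ := hr'K
    have hGw : G (b, Θ (b, v)) ∈ ball (0 : W) r₁ := by
      rw [mem_ball_zero_iff]
      calc ‖G (b, Θ (b, v))‖ ≤ KG * ‖Θ (b, v)‖ := hGbd b hb _ hwδ
        _ ≤ L * (K₁ * ‖v‖) := by
            apply mul_le_mul _ hΘv (norm_nonneg _) hL.le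
            rw [hLdef]; linarith
        _ < L * (K₁ * r') := by gcongr
        _ = L * K₁ * r' := by ring
        _ ≤ r₁ := hr'LK
    refine ⟨hwN, ?_⟩
    have h1 : Ψ (b, G (b, Θ (b, v))) = c • v := by
      rw [hΨconj b (bρ b hb) _ hwr (hr₁r hGw), hΨΘ]
    have h2 := hΘleft b (bρ b hb) _ hGw
    rw [h1] at h2
    exact h2.symm

set_option maxHeartbeats 800000 in
/-- **THE LINEARISING CHART AS AN OPEN PARTIAL HOMEOMORPHISM** [cite: Milnor2006, Thm. 8.2, Cor. 8.4]
[cite: Sternberg1957, Thm. 1] [cite: Koenigs1884]: under the hypotheses of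
`exists_linearization` there is an open partial homeomorphism `𝒦` of `P × W`, over the first projection, analytic with
analytic inverse, with `𝒦 (b, 0) = (b, 0)` and both `𝒦 (b, ·)` and `𝒦.symm (b, ·)` tangent to the identity at `0`,
whose source contains `ball b₀ ρ × {0}` and lies in `N`, whose target is the product `ball b₀ ρ ×ˢ ball 0 s`, and which
CONJUGATES `(b, w) ↦ (b, G (b, w))` to `(b, v) ↦ (b, c • v)`: `𝒦 (b, G (b, w)) = (b, c • (𝒦 (b, w)).2)` whenever
`(b, w)` and `(b, G (b, w))` lie in the source.  (`(𝒦 q).2` is Koenigs's `Ψ q`, `(𝒦.symm p).2` is `Θ p` of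
`exists_parametrization`.) -/
theorem exists_linearizing_openPartialHomeomorph {G : P × W → W} {N : Set (P × W)} {b₀ : P} {c : ℂ} (hN : IsOpen N)
    (hb₀ : (b₀, (0 : W)) ∈ N) (hG : DifferentiableOn ℂ G N) (hG0 : ∀ b : P, (b, (0 : W)) ∈ N → G (b, 0) = 0)
    (hGd : ∀ b : P, (b, (0 : W)) ∈ N → fderiv ℂ (fun w : W => G (b, w)) 0 = c • ContinuousLinearMap.id ℂ W)
    (hc : 1 < ‖c‖) :
    ∃ ρ > (0 : ℝ), ∃ s > (0 : ℝ), ∃ 𝒦 : OpenPartialHomeomorph (P × W) (P × W),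
      𝒦.target = ball b₀ ρ ×ˢ ball (0 : W) s ∧
      𝒦.source ⊆ N ∧
      IsOpen 𝒦.source ∧
      (∀ b ∈ ball b₀ ρ, ((b, (0 : W)) : P × W) ∈ 𝒦.source) ∧
      (∀ q ∈ 𝒦.source, (𝒦 q).1 = q.1) ∧
      (∀ p ∈ 𝒦.target, (𝒦.symm p).1 = p.1) ∧
      (∀ b ∈ ball b₀ ρ, 𝒦 (b, 0) = (b, 0)) ∧
      AnalyticOnNhd ℂ 𝒦 𝒦.source ∧
      AnalyticOnNhd ℂ 𝒦.symm 𝒦.target ∧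
      (∀ b ∈ ball b₀ ρ, HasFDerivAt (fun w : W => (𝒦 (b, w)).2) (ContinuousLinearMap.id ℂ W) 0) ∧
      (∀ b ∈ ball b₀ ρ, HasFDerivAt (fun v : W => (𝒦.symm (b, v)).2) (ContinuousLinearMap.id ℂ W) 0) ∧
      (∀ q ∈ 𝒦.source, (q.1, G q) ∈ 𝒦.source → 𝒦 (q.1, G q) = (q.1, c • (𝒦 q).2)) := by
  obtain ⟨ρ, hρ, r, hr, s, hs, r₁, hr₁, K, Ψ, Θ, hsubN, hΨd, hΨ0, hΨder, hΨconj, hr₁r, hΘd, hΘ0, hΘder, -, hΘinv,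
    hΘleft⟩ := exists_linearization_with_inverse hN hb₀ hG hG0 hGd hc
  set V : Set (P × W) := ball b₀ ρ ×ˢ ball (0 : W) r₁ with hVdef
  set T : Set (P × W) := ball b₀ ρ ×ˢ ball (0 : W) s with hTdef
  have hVo : IsOpen V := isOpen_ball.prod isOpen_ball
  have hTo : IsOpen T := isOpen_ball.prod isOpen_ball
  have hVsub : V ⊆ ball b₀ ρ ×ˢ ball (0 : W) r := Set.prod_mono le_rfl hr₁r
  have hΨcV : ContinuousOn (fun q : P × W => (q.1, Ψ q)) V :=
    continuousOn_fst.prodMk (hΨd.continuousOn.mono hVsub)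
  set src : Set (P × W) := V ∩ (fun q : P × W => (q.1, Ψ q)) ⁻¹' T with hsrcdef
  have hsrco : IsOpen src := hΨcV.isOpen_inter_preimage hVo hTo
  let 𝒦 : OpenPartialHomeomorph (P × W) (P × W) :=
    { toFun := fun q => (q.1, Ψ q)
      invFun := fun p => (p.1, Θ p)
      source := src
      target := T
      map_source' := fun q hq => hq.2
      map_target' := by
        rintro ⟨b, v⟩ ⟨hb, hv⟩
        obtain ⟨h1, h2⟩ := hΘinv b hb v hv
        refine ⟨⟨hb, h1⟩, ?_⟩
        show (b, Ψ (b, Θ (b, v))) ∈ T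
        rw [h2]; exact ⟨hb, hv⟩
      left_inv' := by
        rintro ⟨b, w⟩ ⟨⟨hb, hw⟩, -⟩
        show (b, Θ (b, Ψ (b, w))) = (b, w)
        rw [hΘleft b hb w hw]
      right_inv' := by
        rintro ⟨b, v⟩ ⟨hb, hv⟩
        show (b, Ψ (b, Θ (b, v))) = (b, v)
        rw [(hΘinv b hb v hv).2]
      open_source := hsrco
      open_target := hTo
      continuousOn_toFun := hΨcV.mono inter_subset_left
      continuousOn_invFun := continuousOn_fst.prodMk hΘd.continuousOn }
  have hsrcN : src ⊆ N := fun q hq => hsubN (hVsub hq.1)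
  have h0src : ∀ b ∈ ball b₀ ρ, ((b, (0 : W)) : P × W) ∈ src := by
    intro b hb
    refine ⟨⟨hb, mem_ball_self hr₁⟩, ?_⟩
    show (b, Ψ (b, 0)) ∈ T
    rw [hΨ0 b hb]; exact ⟨hb, mem_ball_self hs⟩
  have hKan : AnalyticOnNhd ℂ (fun q : P × W => (q.1, Ψ q)) src :=
    analyticOnNhd_of_differentiableOn_of_finiteDimensional hsrco
      (differentiableOn_fst.prodMk (hΨd.mono fun q hq => hVsub hq.1))
  have hKsan : AnalyticOnNhd ℂ (fun p : P × W => (p.1, Θ p)) T :=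
    analyticOnNhd_of_differentiableOn_of_finiteDimensional hTo (differentiableOn_fst.prodMk hΘd)
  refine ⟨ρ, hρ, s, hs, 𝒦, rfl, hsrcN, hsrco, h0src, fun q _ => rfl, fun p _ => rfl, fun b hb => ?_, hKan, hKsan,
    fun b hb => hΨder b hb, fun b hb => hΘder b hb, ?_⟩
  · show (b, Ψ (b, 0)) = (b, 0)
    rw [hΨ0 b hb]
  · rintro ⟨b, w⟩ ⟨⟨hb, hw⟩, -⟩ ⟨⟨-, hGw⟩, -⟩
    show (b, Ψ (b, G (b, w))) = (b, c • Ψ (b, w))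
    rw [hΨconj b hb w (hr₁r hw) (hr₁r hGw)]

end Literature.Analysis.Complex.KoenigsLinearization

end
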